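import Mathlib.Analysis.Asymptotics.Defs
import Mathlib.Analysis.Calculus.ContDiff.Basic
import Mathlib.Analysis.SpecialFunctions.Pow.Real
import Mathlib.MeasureTheory.Integral.Lebesgue.Basic
import Literature.Geometry.Lorentzian.InitialData
import Literature.Geometry.Lorentzian.Hypersurface
import Literature.Geometry.Lorentzian.Volume
import HarnessLib

/-!
# The transverse energy of a `U(1)`-symmetric vacuum spacetime (energy per unit Killing length)

Topic `Literature/Geometry/Lorentzian`. Definition request `defn-TransverseEnergy` (route
`FinalStateConjecture/NoVacuumStrings`, informal items ClosedStringsTrapped /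
SubcriticalStringsDisperse): the reduced `2+1` Einstein–wave-map energy of a transverse spacelike
`2`-slice, its normalisation as an energy per unit Killing length, the threshold `E* = 1/4`
(deficit angle `2π`) and the energy–deficit identity for asymptotically flat maximal slices.

## Mathematics (sources)

Let `(V, ⁴g)` be a vacuum spacetime with a spacelike Killing field `K`, `e^{2γ} = ⁴g(K, K)`.
Kaluza–Klein reduction (Geroch 1971; Moncrief 1986; Choquet-Bruhat–Moncrief 2001, §2;
Choquet-Bruhat 2004, §2): `⁴g = e^{-2γ} ³g + e^{2γ} θ²`, and the vacuum equations for `⁴g` are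
the `2+1` Einstein equations `³R_{αβ} = ∂_α u · ∂_β u` for the Lorentzian `3`-metric `³g` on the
orbit space with source the WAVE MAP `u = (γ, ω)` (`ω` the twist potential) into the Poincaré plane
`(ℝ², G)`, `G = 2 dγ² + ½ e^{-4γ} dω²` (curvature `-4`). On a spacelike slice `Σ_t` of the orbit
space with induced metric `g`, second fundamental form `k`, `τ = tr_g k`, unit normal derivative
`u' = N⁻¹ ∂₀ u`, the Hamiltonian constraint reads (Choquet-Bruhat–Moncrief 2001, §2.3.1;
Choquet-Bruhat 2004, §4.1.1)
`R(g) - |k|²_g + τ² = |u'|² + |Du|²_g`, `|u'|² = 2γ'² + ½e^{-4γ}ω'²`,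
`|Du|²_g = g^{ab}(2 ∂_aγ ∂_bγ + ½ e^{-4γ} ∂_aω ∂_bω)`,
and Choquet-Bruhat's FIRST ENERGY of the slice is (Choquet-Bruhat 2004, §4.1.1)
`E(Σ_t) = ∫_{Σ_t} (I₀ + I₁ + ½|h|²_g) μ_g`, `I₀ = ½|u'|² = γ'² + ¼e^{-4γ}ω'²`,
`I₁ = ½|Du|²_g = |Dγ|²_g + ¼e^{-4γ}|Dω|²_g`, `h = k - ½ τ g` (so `|h|² = |k|² - ½τ²`, ibid.).
On a MAXIMAL slice (`τ = 0`) satisfying the constraint the integrand is `½ R(g)`, so by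
Gauss–Bonnet `E` is a total curvature: `E = 2πχ(Σ)` for closed `Σ` (ibid. §4.2), and for a
complete slice `Σ ≅ ℝ²` which is asymptotically flat in the sense of `2+1` gravity,
`g_{ab} = r^{-β}(e_{ab} + O(1/r))` (Ashtekar–Varadarajan 1994, (2.4)), `E = πβ` = the DEFICIT
ANGLE of the asymptotic cone (ibid. (2.1)–(2.3): `α = 1 - 4GM`, `β = 8GM`). The Hamiltonian of
`2+1` gravity generating a unit time translation at infinity has the on-shell value `β/8G`
(ibid. (3.12)) and is bounded, `0 ≤ H < 1/4G` (ibid. §3.2, §4; Deser–Jackiw–'t Hooft 1984: at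
`M = 1/4G` "the cone opens up to become a cylinder" and beyond it space closes up); in the `3+1`
picture `H` is the ENERGY PER UNIT LENGTH along the Killing orbits (ibid. §1, §5; for cylindrical
waves it is `(1/4G)(1 - e^{-4Gc})` with `c` Thorne's C-energy, ibid. (5.5); Berger–Chruściel–
Moncrief 1995, Prop. 3.2: `0 ≤ Δθ < 2π`). With `G₄ = 1` and energy per unit Killing parameter
length, `G₃ = 1` and `H = E/(8π)`: this is `transverseEnergy`, with critical value `1/4`.

## Contents (namespace `Literature.Geometry.Lorentzian`)

* `u1TargetNormSq γ a b = 2a² + ½e^{-4γ}b²`: the Poincaré-plane norm `G_{(γ,ω)}((a,b),(a,b))`.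
* `TransverseSliceData S`: an `InitialDataSet (𝓡 2) S` (`g`, `k` on a `2`-manifold `S`) together
  with the wave-map Cauchy data on the slice: `gamma = γ|_S`, `gammaN = γ'`, `dOmega = Dω`
  (tangential differential of the twist potential, a covector field on `S`), `omegaN = ω'`.
* `TransverseSliceData.kineticDensity` (`I₀`), `gradientDensity` (`I₁`), `normSqTracelessK`
  (`|h|²`), `firstEnergyDensity`, `firstEnergy : ℝ≥0∞` (Choquet-Bruhat's `E`, a lower Lebesgue
  integral against the area measure `riemannianVolume g 2`), `transverseEnergy = E/(8π)` (energy
  per unit Killing length), `SatisfiesHamiltonianConstraint`.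
* `criticalTransverseEnergy = 1/4`, `deficitAngleAV β = πβ`, `IsAsymptoticallyFlatAV`
  (Ashtekar–Varadarajan (2.4)), and the named fact `TransverseSliceData.firstEnergy_eq_deficitAngle`
  (`E = πβ` on complete asymptotically flat maximal slices `≅ ℝ²` satisfying the constraint) with
  its corollary `transverseEnergy = β/8` (`transverseEnergy_eq_of_firstEnergy_eq`).
* `TransverseSliceData.IsTransverseSliceOf`: the data are induced by a spacelike slice
  `f : S → B` with unit normal `ν` of a `3`-manifold `(B, ³g)` carrying the wave-map fields
  `(γ, ω)` — the pattern of `Development.induced_h/induced_k`.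

## Design choices / what is NOT here

* The `3+1 → 2+1` reduction itself (`γ`, twist, `³g`, `Ric(⁴g) = 0 ⇔` Einstein–wave-map) is the
  separate notion `U1Reduction` (definition request of the same route); this file starts from the
  reduced `2+1` data, exactly as Ashtekar–Varadarajan and Choquet-Bruhat do, and links to a
  `2+1` spacetime through the predicate `IsTransverseSliceOf`. For a `4`-dimensional model
  `(𝓩, K)` one composes: `U1Reduction` gives `(B, ³g, γ, ω)`, this file gives `E` of its slices.
* No regularity is imposed on the wave-map data (`γ`, `γ'`, `Dω`, `ω'`): the energies are lower
  Lebesgue integrals of `ENNReal.ofReal` of the densities, meaningful (possibly `+∞`) for arbitrary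
  fields; `I₀, I₁ ≥ 0` are proved (`kineticDensity_nonneg`, `gradientDensity_nonneg`), `|h|² ≥ 0`
  holds for every Riemannian `g` (not re-proved here).
* `|h|²_g := |k|²_g - ½ τ²` is taken as the DEFINITION of the traceless square norm (the identity
  of Choquet-Bruhat 2004, §4.1.1, valid because `tr_g g = 2`).
* Sign conventions for `k` (the library's `K_ν(v,w) = +g(D_v ν, df w)` versus Choquet-Bruhat's
  `k = -(2N)⁻¹ ∂_t g + …`) and the choice of future/past unit normal do not matter: every quantity
  here is quadratic in `k` and in `u'`. The momentum constraint (linear in both) is deliberately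
  not recorded.
* Scale invariance (`³g ↦ λ² ³g`, `u` fixed: `g ↦ λ²g`, `k ↦ λk`, `u' ↦ u'/λ`, `μ_g ↦ λ²μ_g`
  leaves `E` unchanged — `E` is an angle) is a remark, not a lemma.
* The asymptotic flatness class is Ashtekar–Varadarajan's (2.4) with `O(1/r)` remainder and one
  derivative, read in a global homeomorphism `S ≃ₜ ℝ²` smooth near infinity (their "`Σ`
  topologically `ℝ²`" for smooth sources); the energy–deficit identity is vendored as a named fact
  for this class only. `-- TODO(general form): remainder O(r^{-ε}), ε > 0; one conical end of a
  surface of arbitrary topology (E = πβ - 2π(1 - χ)).`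

## References

* A. Ashtekar, M. Varadarajan, *Striking property of the gravitational Hamiltonian*, Phys. Rev.
  D 50 (1994) 4944–4956, arXiv:gr-qc/9406040, §2 (2.1)–(2.4), §3.2 (3.12), §3.3, §4, §5 (5.5).
  [AshtekarVaradarajan1994]
* Y. Choquet-Bruhat, *Future complete U(1) symmetric Einsteinian spacetimes, the unpolarized
  case*, in: The Einstein equations and the large scale behavior of gravitational fields
  (Birkhäuser 2004) 251–298, arXiv:gr-qc/0305060, §2.1–2.4, §3.1, §4.1.1, §4.2.
  [ChoquetBruhat2004U1]
* Y. Choquet-Bruhat, V. Moncrief, *Future global in time Einsteinian spacetimes with U(1)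
  isometry group*, Ann. Henri Poincaré 2 (2001) 1007–1064, §2–§2.3.1. [ChoquetBruhatMoncrief2001]
* V. Moncrief, Ann. Phys. 167 (1986) 118–142 (reduction for spacelike `U(1)`). [Moncrief1986]
* R. Geroch, J. Math. Phys. 12 (1971) 918–924. [Geroch1971]
* S. Deser, R. Jackiw, G. 't Hooft, Ann. Phys. 152 (1984) 220–235. [DeserJackiwtHooft1984]
* B. Berger, P. T. Chruściel, V. Moncrief, Ann. Phys. 237 (1995) 322–354, arXiv:gr-qc/9404005,
  §3 Prop. 3.2, §4.1. [BergerChruscielMoncrief1995]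
* K. S. Thorne, Phys. Rev. 138 (1965) B251–B266 (C-energy). [Thorne1965]
-/

noncomputable section

open Manifold Bundle TopologicalSpace Filter Asymptotics Set
open _root_.MeasureTheory
open scoped ContDiff Topology ENNReal

namespace Literature.Geometry.Lorentzian

/-- Local notation: the model plane `E² = EuclideanSpace ℝ (Fin 2)` (`𝓡 2 = 𝓘(ℝ, E²)`
definitionally). -/
local notation "E²" => EuclideanSpace ℝ (Fin 2)

/-! ### The target of the wave map: the Poincaré plane `(ℝ², 2dγ² + ½e^{-4γ}dω²)` -/

/-- The squared norm `G_{(γ,ω)}((a, b), (a, b)) = 2a² + ½ e^{-4γ} b²` of a tangent vector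
`(a, b) = (δγ, δω)` to the Poincaré plane `(ℝ², G)`, `G = 2(dγ)² + ½ e^{-4γ}(dω)²`, the target of
the wave map `u = (γ, ω)` of the `U(1)` reduction of the vacuum Einstein equations (norm
`e^{2γ}` of the Killing field, twist potential `ω`). Choquet-Bruhat 2004, §2.3 (the metric `G`;
its scalar curvature is `-4`, Remark 2.2) and §4.1.1 (the norms `|u'|²`, `|Du|²`);
Choquet-Bruhat–Moncrief 2001, §2.2. [cite: ChoquetBruhat2004U1, §2.3 and §4.1.1] -/
def u1TargetNormSq (γ a b : ℝ) : ℝ :=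
  2 * a ^ 2 + (1 / 2) * Real.exp (-4 * γ) * b ^ 2

/-- The Poincaré-plane squared norm is nonnegative. [folklore] -/
theorem u1TargetNormSq_nonneg (γ a b : ℝ) : 0 ≤ u1TargetNormSq γ a b := by
  unfold u1TargetNormSq
  positivity

/-- The Poincaré-plane squared norm vanishes exactly at the zero vector (the metric `G` is
positive definite). [folklore] -/
theorem u1TargetNormSq_eq_zero_iff (γ a b : ℝ) : u1TargetNormSq γ a b = 0 ↔ a = 0 ∧ b = 0 := by
  unfold u1TargetNormSq
  constructor
  · intro h
    have h1 : 0 ≤ 2 * a ^ 2 := by positivity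
    have h2 : 0 ≤ (1 / 2) * Real.exp (-4 * γ) * b ^ 2 := by positivity
    have ha : 2 * a ^ 2 = 0 := by linarith
    have hb : (1 / 2) * Real.exp (-4 * γ) * b ^ 2 = 0 := by linarith
    have hexp : Real.exp (-4 * γ) ≠ 0 := (Real.exp_pos _).ne'
    refine ⟨?_, ?_⟩
    · simpa using ha
    · simpa [hexp] using hb
  · rintro ⟨rfl, rfl⟩
    simp

/-! ### Transverse slice data -/

/-- **Transverse slice data**: the Cauchy data induced by the `U(1)`-reduced vacuum Einstein
equations (`2+1` gravity coupled to the wave map `u = (γ, ω)` into the Poincaré plane) on a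
spacelike `2`-slice `S` of the orbit space — an initial data set `(g, k)` on `S`
(`InitialDataSet (𝓡 2) S`: the induced Riemannian metric and second fundamental form of the slice
in the Lorentzian `3`-manifold `(Σ × ℝ, ³g)`), the restriction `gamma = γ|_S` of the log-norm of
the Killing field, its unit-normal derivative `gammaN = γ' = N⁻¹∂₀γ`, the tangential differential
`dOmega = Dω` of the twist potential (a covector field on `S`; the tangential part of the closed
twist `1`-form `E = dω`) and its normal derivative
`omegaN = ω'`. No field equation and no regularity of the wave-map data are part of the structure
(see `SatisfiesHamiltonianConstraint`, `IsTransverseSliceOf`). Choquet-Bruhat 2004, §2.1–2.4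
(`⁴g = e^{-2γ} ³g + e^{2γ}θ²`, twist potential, wave map, `2+1` Einstein equations and the
constraints on `Σ_t`, §2.4.1) and §3.1 (Cauchy data `(g, k)`-part and `u, u̇` on `Σ_t`);
Choquet-Bruhat–Moncrief 2001, §2.3.1. [cite: ChoquetBruhat2004U1, §2.4.1 and §3.1] -/
structure TransverseSliceData (S : Type*) [TopologicalSpace S] [ChartedSpace E² S]
    [IsManifold (𝓡 2) ∞ S] extends InitialDataSet (𝓡 2) S where
  /-- `γ|_S`, where `e^{2γ} = ⁴g(K, K)` is the squared norm of the Killing field. -/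
  gamma : S → ℝ
  /-- The unit-normal derivative `γ' = N⁻¹ ∂₀ γ` of `γ` along the slice. -/
  gammaN : S → ℝ
  /-- The tangential differential `Dω` of the twist potential along the slice (tangential part of
  the closed twist `1`-form `E = dω`). -/
  dOmega (y : S) : TangentSpace (𝓡 2) y →L[ℝ] ℝ
  /-- The unit-normal derivative `ω' = N⁻¹ ∂₀ ω` of the twist potential along the slice. -/
  omegaN : S → ℝ

namespace TransverseSliceData

variable {S : Type*} [TopologicalSpace S] [ChartedSpace E² S] [IsManifold (𝓡 2) ∞ S]
  (T : TransverseSliceData S)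

/-- The tangential differential `Dγ|_y : T_y S → ℝ` of `γ|_S` (Mathlib's `mfderiv`; junk value
`0` where `γ|_S` is not differentiable). Choquet-Bruhat 2004, §4.1.1 (`Du`).
[cite: ChoquetBruhat2004U1, §4.1.1] -/
def dGamma (y : S) : TangentSpace (𝓡 2) y →L[ℝ] ℝ :=
  mfderiv (𝓡 2) 𝓘(ℝ, ℝ) T.gamma y

/-- The **kinetic density** `I₀ = ½|u'|² = (γ')² + ¼ e^{-4γ} (ω')²` of the wave-map data
(`|u'|² = 2γ'² + ½e^{-4γ}ω'²` in the Poincaré-plane metric). Choquet-Bruhat 2004, §4.1.1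
(`|u'|²` and `I₀ ≡ ½|u'|²`). [cite: ChoquetBruhat2004U1, §4.1.1 (I₀)] -/
def kineticDensity (y : S) : ℝ :=
  (1 / 2) * u1TargetNormSq (T.gamma y) (T.gammaN y) (T.omegaN y)

/-- The **gradient density** `I₁ = ½|Du|²_g = |Dγ|²_g + ¼ e^{-4γ} |Dω|²_g` of the wave-map data,
the covector square norms taken with the inverse metric `g^{ab}` of the slice
(`PseudoRiemannianMetric.innerDual`). Choquet-Bruhat 2004, §4.1.1 (`|Du|²_g` and
`I₁ ≡ ½|Du|²_g`). [cite: ChoquetBruhat2004U1, §4.1.1 (I₁)] -/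
def gradientDensity (y : S) : ℝ :=
  T.metric.innerDual y (T.dGamma y).toLinearMap (T.dGamma y).toLinearMap +
    (1 / 4) * Real.exp (-4 * T.gamma y) *
      T.metric.innerDual y (T.dOmega y).toLinearMap (T.dOmega y).toLinearMap

/-- The **square norm of the traceless part** `h = k - ½ τ g` of the second fundamental form,
`|h|²_g = |k|²_g - ½ τ²` (`τ = tr_g k`; the identity uses `tr_g g = 2` and is taken here as the
definition). Choquet-Bruhat 2004, §4.1.1 (the splitting `k = h + ½gτ`,
`|k|²_g = |h|²_g + ½τ²`). [cite: ChoquetBruhat2004U1, §4.1.1 (splitting of k)] -/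
def normSqTracelessK (y : S) : ℝ :=
  T.normSqK y - (1 / 2) * T.traceK y ^ 2

/-- The **first-energy density** `I₀ + I₁ + ½|h|²_g` of the slice. Choquet-Bruhat 2004, §4.1.1
(the integrand of `E(t)`). [cite: ChoquetBruhat2004U1, §4.1.1] -/
def firstEnergyDensity (y : S) : ℝ :=
  T.kineticDensity y + T.gradientDensity y + (1 / 2) * T.normSqTracelessK y

/-- Unfolding lemma for the kinetic density: `I₀ = γ'² + ¼e^{-4γ}ω'²`. Choquet-Bruhat 2004,
§4.1.1. [cite: ChoquetBruhat2004U1, §4.1.1] -/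
theorem kineticDensity_eq (y : S) :
    T.kineticDensity y =
      T.gammaN y ^ 2 + (1 / 4) * Real.exp (-4 * T.gamma y) * T.omegaN y ^ 2 := by
  simp only [kineticDensity, u1TargetNormSq]
  ring

/-- `I₀ ≥ 0`. Choquet-Bruhat 2004, §4.1.1. [cite: ChoquetBruhat2004U1, §4.1.1] -/
theorem kineticDensity_nonneg (y : S) : 0 ≤ T.kineticDensity y := by
  unfold kineticDensity
  exact mul_nonneg (by norm_num) (u1TargetNormSq_nonneg _ _ _)

/-- For the (Riemannian) metric of the slice the inverse metric is positive semidefinite on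
covectors, `g⁻¹(α, α) = g(♯α, ♯α) ≥ 0`. [folklore] -/
theorem innerDual_metric_self_nonneg (y : S) (α : Module.Dual ℝ (TangentSpace (𝓡 2) y)) :
    0 ≤ T.metric.innerDual y α α := by
  rw [PseudoRiemannianMetric.innerDual_eq_val_sharp_sharp]
  by_cases hv : T.metric.sharp y α = 0
  · rw [hv]; simp
  · exact (T.isRiemannian_metric y _ hv).le

/-- `I₁ ≥ 0` (both covector square norms are nonnegative for the Riemannian metric of the slice).
Choquet-Bruhat 2004, §4.1.1. [cite: ChoquetBruhat2004U1, §4.1.1] -/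
theorem gradientDensity_nonneg (y : S) : 0 ≤ T.gradientDensity y := by
  unfold gradientDensity
  have h1 := T.innerDual_metric_self_nonneg y (T.dGamma y).toLinearMap
  have h2 := T.innerDual_metric_self_nonneg y (T.dOmega y).toLinearMap
  positivity

section Energy

variable [T2Space S] [LocallyCompactSpace S] [MeasurableSpace S] [BorelSpace S]

/-- Choquet-Bruhat's **first energy** of the transverse slice,
`E(S) = ∫_S (I₀ + I₁ + ½|h|²_g) μ_g ∈ [0, ∞]`: the wave-map energy on the slice completed by
half the squared `L²(g)` norm of the traceless second fundamental form, as a lower Lebesgue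
integral of `ENNReal.ofReal` of the density against the area measure `μ_g = riemannianVolume g 2`
of the slice (so `E = +∞` is allowed and no integrability is presupposed). On a maximal slice
satisfying the Hamiltonian constraint the integrand is `½ R(g)`. Choquet-Bruhat 2004, §4.1.1
(definition of the first energy `E(t)`, there on a compact `Σ_t`; the same density is
Ashtekar–Varadarajan's volume integrand on `ℝ²`-slices, 1994, §4).
[cite: ChoquetBruhat2004U1, §4.1.1 (E(t))] -/
def firstEnergy : ℝ≥0∞ :=
  ∫⁻ y, ENNReal.ofReal (T.firstEnergyDensity y) ∂(riemannianVolume T.h 2)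

/-- The **transverse energy** (energy per unit Killing length) of the slice:
`transverseEnergy = E/(8π)` with `E` Choquet-Bruhat's first energy. Normalisation: in units
`G₄ = c = 1`, measuring Killing length by the Killing parameter, the reduced theory is `2+1`
gravity with `G₃ = 1`, the physical energy density seen by the normal observer is
`T(n,n) = (I₀ + I₁)/(8π)` (from `³R_{αβ} = ∂_αu·∂_βu`), and on an asymptotically flat maximal
slice `E/(8π) = β/8` is the on-shell value of the Hamiltonian generating a unit time translation
at infinity, i.e. the total energy per unit length along the Killing orbits, which lies in
`[0, 1/4)` (Ashtekar–Varadarajan 1994, (3.12) and §5: "energy per unit length"; deficit angle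
`= 8π ×` energy). See `transverseEnergy_eq_of_firstEnergy_eq`, `criticalTransverseEnergy`.
[cite: AshtekarVaradarajan1994, §3.2 (3.12) and §5] -/
def transverseEnergy : ℝ≥0∞ :=
  T.firstEnergy / ENNReal.ofReal (8 * Real.pi)

/-- Unfolding lemma: `transverseEnergy = firstEnergy / (8π)`. [folklore] -/
theorem transverseEnergy_def :
    T.transverseEnergy = T.firstEnergy / ENNReal.ofReal (8 * Real.pi) := rfl

end Energy

section Constraint

/-- The slice data satisfy the **Hamiltonian constraint** of the `2+1` Einstein–wave-map system:
`R(g) - |k|²_g + τ² = |u'|² + |Du|²_g (= 2(I₀ + I₁))` at every point, the normal–normal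
component of `³R_{αβ} - ½ ³g_{αβ} ³R = T_{αβ}` for the wave-map source
(`InitialDataSet.hamiltonianConstraintFn = R(g) - |k|² + (tr k)²`). Choquet-Bruhat–Moncrief 2001,
§2.3.1 (hamiltonian constraint); Choquet-Bruhat 2004, §2.4.1 and §4.1.1 (hamiltonian constraint
`|u'|² + |Du|²_g + |k|²_g - R(g) - τ² = 0`).
[cite: ChoquetBruhat2004U1, §4.1.1 (hamiltonian constraint)] -/
def SatisfiesHamiltonianConstraint (T : TransverseSliceData S) [T.metric.HasLeviCivita] : Prop :=
  ∀ y, T.hamiltonianConstraintFn y = 2 * (T.kineticDensity y + T.gradientDensity y)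

/-- On a **maximal** slice (`τ = 0`) the traceless square norm is `|k|²`. Choquet-Bruhat 2004,
§4.1.1. [cite: ChoquetBruhat2004U1, §4.1.1] -/
theorem normSqTracelessK_of_isMaximalData (hmax : T.IsMaximalData) (y : S) :
    T.normSqTracelessK y = T.normSqK y := by
  simp [normSqTracelessK, hmax y]

/-- On a maximal slice satisfying the Hamiltonian constraint the first-energy density is half the
scalar curvature of the slice, `I₀ + I₁ + ½|h|² = ½ R(g)` — the pointwise identity behind the
Gauss–Bonnet evaluation of the energy. Choquet-Bruhat 2004, §4.1.1–§4.2;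
Ashtekar–Varadarajan 1994, §3.3 remark 3 and §4 (positivity on `K = 0` slices, after Henneaux).
[cite: ChoquetBruhat2004U1, §4.1.1–4.2] -/
theorem firstEnergyDensity_eq_half_scalarCurvature [T.metric.HasLeviCivita]
    (hmax : T.IsMaximalData) (hC : T.SatisfiesHamiltonianConstraint) (y : S) :
    T.firstEnergyDensity y = (1 / 2) * T.metric.scalarCurvature y := by
  have h1 := hC y
  have h2 : T.hamiltonianConstraintFn y =
      T.metric.scalarCurvature y - T.normSqK y + T.traceK y ^ 2 := rfl
  rw [firstEnergyDensity, T.normSqTracelessK_of_isMaximalData hmax y]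
  have h3 : T.traceK y = 0 := hmax y
  rw [h2, h3] at h1
  linarith

/-- On a maximal slice satisfying the Hamiltonian constraint the first energy is the total
curvature `½ ∫_S R(g) μ_g = ∫_S K dA` (as a lower Lebesgue integral). Choquet-Bruhat 2004, §4.2;
Ashtekar–Varadarajan 1994, §3.3 remark 3. [cite: ChoquetBruhat2004U1, §4.2] -/
theorem firstEnergy_eq_lintegral_scalarCurvature [T.metric.HasLeviCivita] [T2Space S]
    [LocallyCompactSpace S] [MeasurableSpace S] [BorelSpace S] (hmax : T.IsMaximalData)
    (hC : T.SatisfiesHamiltonianConstraint) :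
    T.firstEnergy =
      ∫⁻ y, ENNReal.ofReal ((1 / 2) * T.metric.scalarCurvature y) ∂(riemannianVolume T.h 2) := by
  unfold firstEnergy
  refine lintegral_congr fun y ↦ ?_
  rw [T.firstEnergyDensity_eq_half_scalarCurvature hmax hC y]

end Constraint

end TransverseSliceData

/-! ### The critical energy and the deficit angle -/

/-- The **critical transverse energy** `E* = 1/4` (in units `G₄ = 1`, per unit Killing length):
the strict upper bound `1/4G` of the Hamiltonian of `2+1` gravity coupled to positive-energy
matter on its physical phase space `β < 2` (`H = β/8G`), i.e. the energy whose deficit angle is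
`2π` (`β = 2`: "the cone simply opens up to become a cylinder"; for `β > 2` "space simply curls up
and there is no resemblance to asymptotic flatness"). Ashtekar–Varadarajan 1994, §3.2
(`H < 1/4G`) and §3.3 (Discussion, 1.); Deser–Jackiw–'t Hooft 1984 (static point sources:
deficit angle `8πGM`). [cite: AshtekarVaradarajan1994, §3.2–3.3] -/
def criticalTransverseEnergy : ℝ := 1 / 4

/-- The **deficit angle** `πβ` of a `2`-metric which is asymptotically flat in the sense of
Ashtekar–Varadarajan with exponent `β`, `g_{ab} = r^{-β}(e_{ab} + O(1/r))`: in the coordinates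
`ρ = r^α/α`, `θ̄ = αθ`, `α = 1 - β/2`, the model metric `r^{-β}(dr² + r²dθ²)` is the flat cone
`dρ² + ρ²dθ̄²` with `0 ≤ θ̄ < 2πα`, of deficit `2π(1 - α) = πβ` (`= 8πGM` for `β = 8GM`).
Ashtekar–Varadarajan 1994, (2.1)–(2.3). [cite: AshtekarVaradarajan1994, (2.1)–(2.3)] -/
def deficitAngleAV (β : ℝ) : ℝ := Real.pi * β

/-- The critical exponent `β = 2` has deficit angle `2π`. Ashtekar–Varadarajan 1994, §3.3.
[cite: AshtekarVaradarajan1994, §3.3] -/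
theorem deficitAngleAV_two : deficitAngleAV 2 = 2 * Real.pi := by
  unfold deficitAngleAV; ring

/-- `E* = (deficit 2π)/(8π)`: the critical transverse energy is the energy whose deficit angle is
`2π`. Ashtekar–Varadarajan 1994, §3.2–3.3. [cite: AshtekarVaradarajan1994, §3.2–3.3] -/
theorem criticalTransverseEnergy_eq :
    criticalTransverseEnergy = deficitAngleAV 2 / (8 * Real.pi) := by
  rw [deficitAngleAV_two, criticalTransverseEnergy]
  have hπ : Real.pi ≠ 0 := Real.pi_ne_zero
  field_simp
  ring

namespace TransverseSliceData

variable {S : Type*} [TopologicalSpace S] [ChartedSpace E² S] [IsManifold (𝓡 2) ∞ S]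

/-- **Sub-criticality in terms of the first energy**: `transverseEnergy < E* = 1/4` iff
Choquet-Bruhat's first energy is `< 2π` (the deficit-angle threshold). Ashtekar–Varadarajan 1994,
§3.2–3.3. [cite: AshtekarVaradarajan1994, §3.2–3.3] -/
theorem transverseEnergy_lt_critical_iff [T2Space S] [LocallyCompactSpace S] [MeasurableSpace S]
    [BorelSpace S] (T : TransverseSliceData S) :
    T.transverseEnergy < ENNReal.ofReal criticalTransverseEnergy ↔
      T.firstEnergy < ENNReal.ofReal (2 * Real.pi) := by
  have h8 : (0 : ℝ) < 8 * Real.pi := by positivity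
  rw [transverseEnergy, ENNReal.div_lt_iff (Or.inl ((ENNReal.ofReal_pos.2 h8).ne'))
    (Or.inl ENNReal.ofReal_ne_top), ← ENNReal.ofReal_mul (by norm_num [criticalTransverseEnergy])]
  have : criticalTransverseEnergy * (8 * Real.pi) = 2 * Real.pi := by
    unfold criticalTransverseEnergy; ring
  rw [this]

/-! ### Asymptotic flatness in the sense of `2+1` gravity and the energy–deficit identity -/

/-- The **components of the slice metric in a plane chart**: for a map `ψ : ℝ² → S` (meant: the
inverse of a homeomorphism `S ≃ₜ ℝ²`, smooth near infinity) and `x ∈ ℝ²`, the pullback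
`(ψ^* g)_x ∈ E² →L[ℝ] E² →L[ℝ] ℝ` (`g_{ab}(x) = chartCoeff T ψ x e_a e_b`; junk value `0` where
`ψ` is not differentiable, inherited from `pullbackBilin`). Ashtekar–Varadarajan 1994, §2 ("the
components of the tensor field in the Cartesian chart").
[cite: AshtekarVaradarajan1994, §2 (2.4)] -/
def chartCoeff (T : TransverseSliceData S) (ψ : E² → S) (x : E²) : E² →L[ℝ] E² →L[ℝ] ℝ :=
  pullbackBilin (I := 𝓡 2) (I' := 𝓘(ℝ, E²)) ψ T.h.inner x

/-- `g_{ab}(x) = g_{ψ x}(dψ_x e_a, dψ_x e_b)`. [folklore] -/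
@[simp]
theorem chartCoeff_apply (T : TransverseSliceData S) (ψ : E² → S) (x : E²) (v w : E²) :
    T.chartCoeff ψ x v w =
      T.h.inner (ψ x) (mfderiv 𝓘(ℝ, E²) (𝓡 2) ψ x v) (mfderiv 𝓘(ℝ, E²) (𝓡 2) ψ x w) :=
  rfl

/-- The slice `(S, g)` is **asymptotically flat in the sense of `2+1` gravity with exponent `β`**
(Ashtekar–Varadarajan): `S` is topologically `ℝ²` — there is a homeomorphism `Φ : S ≃ₜ ℝ²` —
whose inverse is smooth on an exterior region `{R₀ < ‖x‖}`, and in these Cartesian coordinates the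
components of the metric satisfy `g_{ab} = ‖x‖^{-β}(e_{ab} + O(1/‖x‖))` with the derivative
convention `∂(O(1/r)) = O(1/r²)`, `∂∂(O(1/r)) = O(1/r³)` (two derivatives, as used for the
curvature fall-off (2.8)): for `m ≤ 2`,
`‖∂^m(‖x‖^β (Φ⁻¹)^* g - δ)(x)‖ = O(‖x‖^{-1-m})` as `‖x‖ → ∞` (`iteratedFDeriv` along
`Bornology.cobounded`; `δ = innerSL ℝ`; compare `AFEnd.IsMetricAsymptoticallyFlat`). No condition
on `k` or on the matter fields is imposed here (AV (2.6) and the stress-energy fall-off are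
separate hypotheses of their phase space). Ashtekar–Varadarajan 1994, §2, (2.4) with the
parenthetical derivative convention following it, and (2.8); "the Cauchy surfaces can be taken to
be topologically `ℝ²`" (§1). [cite: AshtekarVaradarajan1994, §2 (2.4)] -/
def IsAsymptoticallyFlatAV (T : TransverseSliceData S) (β : ℝ) : Prop :=
  ∃ (Φ : S ≃ₜ E²) (R₀ : ℝ), 0 < R₀ ∧
    ContMDiffOn 𝓘(ℝ, E²) (𝓡 2) ∞ (Φ.symm : E² → S) {x | R₀ < ‖x‖} ∧
    ∀ m : ℕ, m ≤ 2 →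
      (fun x : E² ↦ ‖iteratedFDeriv ℝ m
          (fun z : E² ↦ ‖z‖ ^ β • T.chartCoeff Φ.symm z - (innerSL ℝ : E² →L[ℝ] E² →L[ℝ] ℝ)) x‖)
        =O[Bornology.cobounded E²] fun x ↦ ‖x‖ ^ (-1 - (m : ℝ))

/-- **The first energy of an asymptotically flat maximal slice is its deficit angle** (named
fact). Let the transverse slice data `T` on `S` be asymptotically flat in the sense of
Ashtekar–Varadarajan with exponent `β < 2` (so `S ≅ ℝ²` and `(S, g)` is complete), maximal
(`tr_g k = 0`) and satisfy the Hamiltonian constraint. Then Choquet-Bruhat's first energy equals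
`πβ`, the deficit angle of the asymptotic cone: by the constraint the integrand is `½R(g)`
(`firstEnergyDensity_eq_half_scalarCurvature`), and `½∫_S R(g) μ_g = ∫_S K dA = πβ` by the
Gauss–Bonnet theorem on the discs `{r ≤ R}` (the geodesic curvature integral of the coordinate
circles tends to the cone angle `2π - πβ`). This is the evaluation of the first energy by
Gauss–Bonnet of Choquet-Bruhat 2004, §4.2 in the asymptotically flat setting of
Ashtekar–Varadarajan 1994, where it is the statement that on a `K = 0` slice satisfying the
constraints the Hamiltonian `(16πG)⁻¹∫(√q R - …) + β/8G`-surface term has the value `β/8G` with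
`∫ √q R` a pure divergence equal to the surface term (§3.2 (3.11)–(3.12), §3.3 remark 3, §4,
after Henneaux); for cylindrical waves it is Berger–Chruściel–Moncrief 1995, Prop. 3.2.
[cite: AshtekarVaradarajan1994, §3.2 (3.11)–(3.12) and §3.3 remark 3] -/
def firstEnergy_eq_deficitAngle : Prop :=
  ∀ [T2Space S] [LocallyCompactSpace S] [MeasurableSpace S] [BorelSpace S]
    (T : TransverseSliceData S) [T.metric.HasLeviCivita] (β : ℝ), β < 2 →
    T.IsAsymptoticallyFlatAV β → T.IsMaximalData → T.SatisfiesHamiltonianConstraint →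
      T.firstEnergy = ENNReal.ofReal (deficitAngleAV β)

/-- **Energy per unit length `= β/8`** (corollary of the named fact
`firstEnergy_eq_deficitAngle`, taken as the hypothesis `h`): on an asymptotically flat (exponent
`β < 2`) maximal slice satisfying the Hamiltonian constraint, `transverseEnergy = πβ/(8π) = β/8`,
the on-shell value `β/8G` (`G = 1`) of the Hamiltonian of Ashtekar–Varadarajan 1994, (3.12); in
particular it is `< criticalTransverseEnergy = 1/4`. [cite: AshtekarVaradarajan1994, §3.2 (3.12)] -/
theorem transverseEnergy_eq_of_firstEnergy_eq (h : firstEnergy_eq_deficitAngle (S := S))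
    [T2Space S] [LocallyCompactSpace S] [MeasurableSpace S] [BorelSpace S]
    (T : TransverseSliceData S) [T.metric.HasLeviCivita] {β : ℝ} (hβ : β < 2)
    (hAF : T.IsAsymptoticallyFlatAV β) (hmax : T.IsMaximalData)
    (hC : T.SatisfiesHamiltonianConstraint) :
    T.transverseEnergy = ENNReal.ofReal (β / 8) := by
  rw [transverseEnergy, h T β hβ hAF hmax hC, deficitAngleAV,
    ← ENNReal.ofReal_div_of_pos (by positivity)]
  congr 1
  have hπ : Real.pi ≠ 0 := Real.pi_ne_zero
  field_simp

/-! ### Slices of a `2+1` Einstein–wave-map spacetime -/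

section Induced

variable {EB : Type*} [NormedAddCommGroup EB] [NormedSpace ℝ EB] {HB : Type*}
  [TopologicalSpace HB] {IB : ModelWithCorners ℝ EB HB} {B : Type*} [TopologicalSpace B]
  [ChartedSpace HB B] [IsManifold IB ∞ B] {n : ℕ∞ω}
  [FiniteDimensional ℝ EB] [CompleteSpace EB] [Fact (1 ≤ n)]

/-- The transverse slice data `T` on `S` are **induced by the slice `f : S → B` with unit normal
`ν` of the `3`-manifold `(B, ³g)` carrying the wave-map fields `(γ, ω)`** (`w = ω` in the Lean
signature, `ω` being notation; meant: `(B, ³g)` the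
Lorentzian orbit space of a `U(1)`-symmetric vacuum spacetime, `e^{2γ}` the squared norm of the
Killing field, `ω` the twist potential): `ν` is a unit normal of sign `-1` along `f`, the data
metric is the induced metric `f^* ³g = g`, the data tensor `k` is the second fundamental form of
`f` with respect to `ν` (Levi-Civita connection of `³g`, standing hypothesis `[³g.HasLeviCivita]`),
and the wave-map data are the restrictions and unit-normal derivatives of `(γ, ω)`:
`gamma = γ ∘ f`, `gammaN = dγ(ν)`, `dOmega = f^*(dω)`, `omegaN = dω(ν)`. This is the pattern of
`Development.induced_h/induced_k`; the sign of `ν` and the sign convention for `k` are immaterial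
for the energies (quadratic). Choquet-Bruhat 2004, §2.1, §2.4.1 and §3.1 (the data `(g, k)` and
`(u, u̇)` on `Σ_t`; `u' = N⁻¹∂₀u` the unit-normal derivative, §2.4.1); Choquet-Bruhat–Moncrief
2001, §2.3.1. [cite: ChoquetBruhat2004U1, §2.4.1 and §3.1] -/
structure IsTransverseSliceOf (T : TransverseSliceData S)
    (g₃ : PseudoRiemannianMetric IB n EB (TangentSpace IB : B → Type _)) (γ w : B → ℝ)
    (f : S → B) (ν : NormalField IB f) : Prop where
  /-- `ν` is a unit normal of sign `-1` (timelike) along `f`. -/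
  isUnitNormal : g₃.IsUnitNormal (𝓡 2) f ν (-1)
  /-- The induced metric is the data metric: `f^* ³g = g`. -/
  induced_h : ∀ y : S, pullbackBilin (I := IB) (I' := 𝓡 2) f g₃.val y = T.h.inner y
  /-- The second fundamental form of `f` w.r.t. `ν` is the data tensor `k`. -/
  induced_k : ∀ [g₃.HasLeviCivita] (y : S), g₃.secondFundamentalForm (𝓡 2) f ν y = T.kBilin y
  /-- `gamma = γ ∘ f`. -/
  gamma_eq : ∀ y : S, T.gamma y = γ (f y)
  /-- `gammaN = dγ(ν)`, the unit-normal derivative of `γ`. -/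
  gammaN_eq : ∀ y : S, T.gammaN y = mfderiv IB 𝓘(ℝ, ℝ) γ (f y) (ν y)
  /-- `dOmega = f^*(dω)`, the tangential differential of the twist potential. -/
  dOmega_eq : ∀ (y : S) (v : TangentSpace (𝓡 2) y),
    T.dOmega y v = mfderiv IB 𝓘(ℝ, ℝ) w (f y) (mfderiv (𝓡 2) IB f y v)
  /-- `omegaN = dω(ν)`, the unit-normal derivative of the twist potential. -/
  omegaN_eq : ∀ y : S, T.omegaN y = mfderiv IB 𝓘(ℝ, ℝ) w (f y) (ν y)

omit [CompleteSpace EB] [Fact (1 ≤ n)] in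
/-- For induced data the kinetic density is `I₀ = dγ(ν)² + ¼ e^{-4γ∘f} dω(ν)²`.
Choquet-Bruhat 2004, §4.1.1. [cite: ChoquetBruhat2004U1, §4.1.1] -/
theorem IsTransverseSliceOf.kineticDensity_eq {T : TransverseSliceData S}
    {g₃ : PseudoRiemannianMetric IB n EB (TangentSpace IB : B → Type _)} {γ w : B → ℝ}
    {f : S → B} {ν : NormalField IB f} (h : T.IsTransverseSliceOf g₃ γ w f ν) (y : S) :
    T.kineticDensity y =
      (show ℝ from mfderiv IB 𝓘(ℝ, ℝ) γ (f y) (ν y)) ^ 2 +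
        (1 / 4) * Real.exp (-4 * γ (f y)) *
          (show ℝ from mfderiv IB 𝓘(ℝ, ℝ) w (f y) (ν y)) ^ 2 := by
  rw [T.kineticDensity_eq, h.gamma_eq y, h.gammaN_eq y, h.omegaN_eq y]

end Induced

end TransverseSliceData

end Literature.Geometry.Lorentzian

end
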